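import Summits.QuantumFields.YangMills.Theorems.BalabanUVNodesN16SlotWindowReading
import HarnessLib

/-!
# Route «BalabanUVNodes», cluster K4 «SpineRates» — node N16 = NE3: THE WINDOW RECIPE IN LINE-EXACT AND LINEAR FORM — N07's leaf letters `(b', c')` enter the
# slot only through its four displayed `(b', c')`-lines; with the class radius free below the averaging letter the LINEAR recipe `0 ≤ b' ≤ α∕2048`, `0 ≤ c' ≤ α∕24`
# meets them, so N07's linear leaf `b' = c' = C·ε` sits at `ε ≤ α∕(2048·C)` (dag-ref-B READ-445's A2-at-content note on the quadratic recipe `b', c' ≤ α²`)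

Cell `pub-ymgap`, seat `pub-ymgap-dag-n16-e` (R134 acceleration seat (a), strategy s2 = BY-NAME KNIT at the record; HUMAN RULING D-0062; chair R424 venue),
generation 4, file 17 (THEOREMS ONLY, 0 `def`, 0 `sorry`, standard axioms).  `bears_on: R4∕N16 · K3′ SpineGivenEndpointR12 (stmt-QuantumFields-19908)`.  Filed
`--supports stmt-QuantumFields-19908 --as helper`.  Imports this seat's file 14 `BalabanUVNodesN16SlotWindowReading` (p480498; through it file 13 p480052 and file 12
p474753: `LeafSlot`, `InEndRegime`, `inEndRegime_ofRecord_of_window`, `s_N16_rRec₁₂On_readingOfRecord₁₂_of_leafSlot`, `s_N16_rRec₁₂_of_constLayer_leafSlot`, `readingOfRecord₁₂`).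
Restates nothing; cites by name.

WHY (dag-ref-B g11 READ-445, pub-ymgap INBOX l.15091, REFEREE NOTE «A2 at the CONTENT level»; this seat's ANSWER l.15125).  File 10's recipe and file 13 §2's
quadratic corollary (`0 ≤ b', c' ≤ α²`) put N07's leaf letters QUADRATICALLY below the averaging letter; N07's `LeafH3sup 4 L Nper ε b' c' dom` over ALL periodic data can
only be LINEAR in the flux (`b', c' ≍ C·ε`, [Balaban1985Variational] Thm 1 (8)+(10)), so the quadratic recipe confines the class radius to `ε ≤ α²∕C`.  The slot itself
asks of `(b', c')` only its four displayed lines — regularity `2¹⁵·5²·8²·L²·b' ≤ 1`, frame `M_L(c' + K_L b'²) ≤ 1`, (3.35) size `b' + C₀b'² < α`, current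
`12(c' + K_L b'²) < α` — and these tolerate the LINEAR recipe `b' ≤ α∕2048` (the regularity line with `L²α ≤ 1∕40960`: `52428800·L²α∕2048 ≤ 0.625`), `c' ≤ α∕24`.
THIS FILE proves the recipe in LINE-EXACT form (necessary and sufficient w.r.t. the slot), the LINEAR corollary, and the N16 line at the reading of record in the linear
currency; the real arithmetic is split into two PUBLIC slot-free lemmas (§1) that the β-generic twin (file 18, over dag-n16-c's `LeafSlotHolder`) reuses verbatim.

CONTENT ([folklore] bookkeeping + elementary real arithmetic on OUR displayed lines).
§1 `slotLetterLines` — from the five α-bounds' relevant members, `B ≤ B₁'`, `16·B₁'·c₁' ≤ 1`, `0 < Λ₁`, `177α(B_h+B) ≤ Λ₂'` and ANY size `0 ≤ X < α`: the eleven derived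
   numeric lines of the slot (`16·B·c₁' ≤ 1`, the four α-lines, `(0+1)X ≤ 1∕2`, the `C₃₃₅ = 1` line, the four Λ-lines); `leafLines_of_linear` — `b' ≤ α∕2048`, `c' ≤ α∕24`
   give the four `(b', c')`-lines.
§2 `leafSlot_ofRecord_of_window_lines` (the slot's four `(b', c')`-lines as hypotheses; `o.ε < α` free) and `leafSlot_ofRecord_of_window_linear` (`0 ≤ b' ≤ α∕2048`,
   `0 ≤ c' ≤ α∕24`) ⟹ `Thm4Body → Prop3Body → LeafH3sup 4 F.L o.Nper o.ε b' c' o.dom → LeafSlot (ne3OfRecord₁₁ F o)`.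
§3 `s_N16_rRec₁₂On_readingOfRecord₁₂_of_window_linear` ∕ `s_N16_rRec₁₂_readingOfRecord₁₂_of_window_linear` — file 14's two compositions in the linear currency (the content
   once per family; every other hypothesis a displayed letter inequality).

HONEST FRAMING.  Kernel bookkeeping + real arithmetic; the three content clauses are HYPOTHESES (N05's leaf at Hölder exponent `β = 1` as typed — dag-n16-c
LOCATED-N16-HOLDER-PIN, ruling awaited — modulo its sockets; N07's Thm 1 TYPE), asserted for no family; nothing of Bałaban's asserted; **N16 ∕ NE3 NOT discharged**;
count-neutral; one finite four-torus at fixed ε — NOT ℝ⁴, NOT infinite volume, NOT OS, NOT a mass gap, NOT Clay.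
-/

set_option autoImplicit false

open scoped BigOperators Matrix Matrix.Norms.L2Operator
open NormedSpace

namespace Summit.QuantumFields.YangMills.BalabanUVNodes.N16SlotWindowLinear

open Literature.MathematicalPhysics.QuantumFieldTheory.Balaban1983to89
open Literature.MathematicalPhysics.QuantumFieldTheory.Balaban1983to89.T4Continuum (T4Family ULoop)
open B7Prop1Explicit B7Prop2Explicit
open B7Prop3Flat (c3)
open B8LeafModelZd (ZdIdx)
open B8LeafModelZd3 (zdGF3)
open Node00 (IsDatumOfRecord₁₂C Stage12Params NE3Objects₁₁ NE3Letters₁₁ NE2Objects₁₁ ne3ConstLayerOfRecord₁₁ ne3NperOfRecord₁₁ ne3DomOfRecord₁₁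
  one_le_ne3NperOfRecord₁₁)
open Summit.QuantumFields.BalabanUV.T4Continuum
open BlockAverageCurrent (curConst curConst_nonneg)
open NE3RightInverseSupLetters (frameC)
open NE3.LeafIndexSockets (LeafH3sup)
open YMDAG.UVSplit (Datum NE3Carriers NE1pCarriers S_N16 ne3OfRecord₁₁ RRec₁₂ RRec₁₂On readingOfRecord₁₂)
open Summit.QuantumFields.YangMills.BalabanUVNodes.N16Regime (InEndRegime radiusOfRecord constOfRecord)
open Summit.QuantumFields.YangMills.BalabanUVNodes.N16LeafSlot (LeafSlot)
open Summit.QuantumFields.YangMills.BalabanUVNodes.N16AtRRec12ConstLayer (s_N16_rRec₁₂_of_constLayer_leafSlot)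
open Summit.QuantumFields.YangMills.BalabanUVNodes.N16AtRRec12On (s_N16_rRec₁₂On_readingOfRecord₁₂_of_leafSlot)
open Summit.QuantumFields.YangMills.BalabanUVNodes.N16SlotWindow (inEndRegime_ofRecord_of_window)

noncomputable section

/-! ## §1 The slot's numeric lines from the window bounds — two slot-free arithmetic lemmas -/

/-- **THE ELEVEN DERIVED NUMERIC LINES OF THE SLOT** (slot-free arithmetic).  From `0 < α ≤ c₁'∕177`, `α ≤ Λ₁∕(1770·B+1)`, `α ≤ c2' 4 L∕2`, `α ≤ 10⁻⁹`, `0 < B ≤ B₁'`,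
`16·(B₁'·c₁') ≤ 1`, `0 < Λ₁`, `177·α·(B_h+B) ≤ Λ₂'` and any (3.35) size `X < α`, any `Y`: `16·(B·c₁') ≤ 1`, `C₀(4)·α ≤ 1∕3`, `2α ≤ c2' 4 L`, `11·4²·α ≤ 1∕6`,
`α + 11·4²·α ≤ c₁'`, `(0+1)·X ≤ 1∕2`, the `C₃₃₅ = 1` line at `Mc = 0`, and the four Λ-lines with `A = α + 11·4²·α`. [folklore] -/
theorem slotLetterLines (L : ℕ) {c₁' B₁' B Bh Λ₁ Λ₂' α X : ℝ} (Y : ℝ) (hα : 0 < α) (hα1 : α ≤ c₁' / 177) (hα2 : α ≤ Λ₁ / (1770 * B + 1))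
    (hα3 : α ≤ c2' 4 L / 2) (hα5 : α ≤ 1 / 10 ^ 9) (hB0 : 0 < B) (hBB' : B ≤ B₁') (hc₁' : 0 < c₁') (h16' : 16 * (B₁' * c₁') ≤ 1) (hΛ₁ : 0 < Λ₁)
    (hΛ₂' : 177 * α * (Bh + B) ≤ Λ₂') (hXα : X < α) :
    16 * (B * c₁') ≤ 1 ∧ C0 4 * α ≤ 1 / 3 ∧ 2 * α ≤ c2' 4 L ∧ 11 * (4 : ℝ) ^ 2 * α ≤ 1 / 6 ∧ α + 11 * (4 : ℝ) ^ 2 * α ≤ c₁' ∧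
      (0 + 1) * X ≤ 1 / 2 ∧ 2 * (0 + 1) * X + 2 * 0 * (2 * Y) + 4 * 0 * (1 + 2 * 0) * X ^ 2 < 1 ∧
      B * (α + 11 * (4 : ℝ) ^ 2 * α) ≤ Λ₁ ∧ B * (α + 11 * (4 : ℝ) ^ 2 * α) + 2 * X * Λ₁ ≤ Λ₁ ∧
      B * (α + 11 * (4 : ℝ) ^ 2 * α) + 16 * X * (B * (α + 11 * (4 : ℝ) ^ 2 * α)) ≤ Λ₁ ∧
      Bh * (α + 11 * (4 : ℝ) ^ 2 * α) + 8 * X * (B * (α + 11 * (4 : ℝ) ^ 2 * α)) ≤ Λ₂' := by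
  have hXs : X ≤ 1 / 10 ^ 9 := hXα.le.trans hα5
  have h16 : 16 * (B * c₁') ≤ 1 := by linarith only [h16', mul_le_mul_of_nonneg_right hBB' hc₁'.le]
  have hA3 : C0 4 * α ≤ 1 / 3 := by unfold C0; push_cast; linarith only [hα5, hα]
  have hA2 : 2 * α ≤ c2' 4 L := by linarith only [hα3]
  have hAs : 11 * (4 : ℝ) ^ 2 * α ≤ 1 / 6 := by linarith only [hα5]
  have hAc : α + 11 * (4 : ℝ) ^ 2 * α ≤ c₁' := by
    rw [le_div_iff₀ (by norm_num : (0 : ℝ) < 177)] at hα1; linarith only [hα1]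
  have hA0 : 0 ≤ α + 11 * (4 : ℝ) ^ 2 * α := by positivity
  have hBA : B * (α + 11 * (4 : ℝ) ^ 2 * α) ≤ Λ₁ / 10 := by
    have hden' : 0 < 1770 * B + 1 := by positivity
    rw [le_div_iff₀ hden'] at hα2
    rw [le_div_iff₀ (by norm_num : (0 : ℝ) < 10)]
    have e : B * (α + 11 * (4 : ℝ) ^ 2 * α) * 10 = α * (1770 * B + 1) - α := by ring
    rw [e]; linarith only [hα2, hα]
  have hBA0 : 0 ≤ B * (α + 11 * (4 : ℝ) ^ 2 * α) := mul_nonneg hB0.le hA0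
  refine ⟨h16, hA3, hA2, hAs, hAc, by linarith only [hXs], by nlinarith only [hXs], by linarith only [hBA, hΛ₁],
    by nlinarith only [hBA, hXs, hΛ₁], by nlinarith only [hBA, hXs, hBA0, hΛ₁], ?_⟩
  have h8 : 8 * X * (B * (α + 11 * (4 : ℝ) ^ 2 * α)) ≤ B * (α + 11 * (4 : ℝ) ^ 2 * α) := by nlinarith only [hXs, hBA0]
  have e : Bh * (α + 11 * (4 : ℝ) ^ 2 * α) + B * (α + 11 * (4 : ℝ) ^ 2 * α) = 177 * α * (Bh + B) := by ring
  linarith only [h8, e.le, hΛ₂']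

/-- **THE LINEAR RECIPE MEETS THE SLOT's FOUR `(b', c')`-LINES** (slot-free arithmetic): for `0 < α ≤ c2' 4 L∕2`, `α ≤ 1∕((M_L+12)(1+K_L)+1)`, `α ≤ 10⁻⁹`
(`M_L = 23040·4⁴·(frameC 4 L+4)³`, `K_L = curConst 4 L`) and `0 ≤ b' ≤ α∕2048`, `c' ≤ α∕24`: the regularity line `2¹⁵·5²·8²·L²·b' ≤ 1`, the frame line
`M_L(c' + K_L b'²) ≤ 1`, the (3.35) size `b' + C₀b'² < α` and the current line `12(c' + K_L b'²) < α` (`L ≥ 1`). [folklore] -/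
theorem leafLines_of_linear {L : ℕ} (hL : 1 ≤ L) {α b' c' : ℝ} (hα : 0 < α) (hα3 : α ≤ c2' 4 L / 2)
    (hα4 : α ≤ 1 / ((23040 * (4 : ℝ) ^ 4 * (frameC 4 L + 4) ^ 3 + 12) * (1 + curConst 4 L) + 1)) (hα5 : α ≤ 1 / 10 ^ 9)
    (hb' : 0 ≤ b') (hb'α : b' ≤ α / 2048) (hc'α : c' ≤ α / 24) :
    2 ^ 15 * ((4 : ℝ) + 1) ^ 2 * ((4 : ℝ) + 4) ^ 2 * (L : ℝ) ^ 2 * b' ≤ 1 ∧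
      23040 * (4 : ℝ) ^ 4 * (frameC 4 L + 4) ^ 3 * (c' + curConst 4 L * b' ^ 2) ≤ 1 ∧
      b' + 226 * (8 * ((4 : ℝ) + 1) * ((4 : ℝ) + 4)) ^ 2 * b' ^ 2 < α ∧ 4 * ((4 : ℝ) - 1) * (c' + curConst 4 L * b' ^ 2) < α := by
  -- the big constant of the frame line, the current constant
  obtain ⟨M, hM_def, hM0⟩ : ∃ M : ℝ, M = 23040 * (4 : ℝ) ^ 4 * (frameC 4 L + 4) ^ 3 ∧ 0 ≤ M :=
    ⟨_, rfl, by have : 0 ≤ frameC 4 L := by unfold frameC; positivity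
                positivity⟩
  rw [← hM_def] at hα4 ⊢
  have hK := curConst_nonneg (d := 4) L
  have hden : 0 < (M + 12) * (1 + curConst 4 L) + 1 := by positivity
  have hαK : α * ((M + 12) * (1 + curConst 4 L) + 1) ≤ 1 := by rw [le_div_iff₀ hden] at hα4; exact hα4
  -- `Mα ≤ 1`, `12·K·α ≤ 1`, `α ≤ 1`
  have hMα : M * α ≤ 1 := by nlinarith only [hαK, hM0, hK, hα]
  have hKα : 12 * (curConst 4 L * α) ≤ 1 := by nlinarith only [hαK, hM0, hK, hα]
  have hα1 : α ≤ 1 := hα5.trans (by norm_num)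
  -- `K·b'² ≤ α∕48 · (12Kα)∕(2048²∕… )`: crude bounds `b'² ≤ (α∕2048)·b'`, `K b'^2 ≤ K α b' ∕ 2048`
  have hb'2 : b' ^ 2 ≤ α / 2048 * b' := by nlinarith only [hb', hb'α]
  have hKb : curConst 4 L * b' ^ 2 ≤ b' / 2048 := by
    have h1 : curConst 4 L * b' ^ 2 ≤ curConst 4 L * (α / 2048 * b') := mul_le_mul_of_nonneg_left hb'2 hK
    have h2 : curConst 4 L * (α / 2048 * b') = (curConst 4 L * α) * b' / 2048 := by ring
    have h3 : (curConst 4 L * α) * b' ≤ 1 * b' :=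
      mul_le_mul_of_nonneg_right (by linarith only [hKα, mul_nonneg hK hα.le]) hb'
    rw [h2] at h1
    linarith only [h1, h3]
  refine ⟨?_, ?_, ?_, ?_⟩
  · -- regularity: `L²·α ≤ 1∕40960`
    have hL2α : (L : ℝ) ^ 2 * α ≤ 1 / 40960 := by
      have hpos : (0 : ℝ) < (L : ℝ) ^ 2 := by have : (1 : ℝ) ≤ L := by exact_mod_cast hL
                                              positivity
      have e : c2' 4 L / 2 = (1 / 40960) / (L : ℝ) ^ 2 := by unfold c2'; push_cast; field_simp; ring
      rw [e, le_div_iff₀ hpos] at hα3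
      linarith only [hα3]
    calc 2 ^ 15 * ((4 : ℝ) + 1) ^ 2 * ((4 : ℝ) + 4) ^ 2 * (L : ℝ) ^ 2 * b'
        ≤ 2 ^ 15 * ((4 : ℝ) + 1) ^ 2 * ((4 : ℝ) + 4) ^ 2 * (L : ℝ) ^ 2 * (α / 2048) := mul_le_mul_of_nonneg_left hb'α (by positivity)
      _ = 25600 * ((L : ℝ) ^ 2 * α) := by ring
      _ ≤ 25600 * (1 / 40960) := mul_le_mul_of_nonneg_left hL2α (by norm_num)
      _ ≤ 1 := by norm_num
  · -- frame: `M(c' + K b'²) ≤ M(α∕24 + α∕2048²·…) ≤ Mα∕24 + Mα∕2048 ≤ 1`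
    have h1 : c' + curConst 4 L * b' ^ 2 ≤ α / 24 + α / 2048 / 2048 := by linarith only [hc'α, hKb, hb'α]
    calc M * (c' + curConst 4 L * b' ^ 2) ≤ M * (α / 24 + α / 2048 / 2048) := mul_le_mul_of_nonneg_left h1 hM0
      _ = M * α * (1 / 24 + 1 / 2048 / 2048) := by ring
      _ ≤ 1 * (1 / 24 + 1 / 2048 / 2048) := mul_le_mul_of_nonneg_right hMα (by norm_num)
      _ ≤ 1 := by norm_num
  · -- (3.35) size: `b' + C₀ b'² ≤ α∕2048 + C₀·(α∕2048)·b' < α`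
    have hC0b : 226 * (8 * ((4 : ℝ) + 1) * ((4 : ℝ) + 4)) ^ 2 * b' ^ 2 ≤ 226 * (8 * ((4 : ℝ) + 1) * ((4 : ℝ) + 4)) ^ 2 * (α / 2048 * b') :=
      mul_le_mul_of_nonneg_left hb'2 (by positivity)
    have h1 : 226 * (8 * ((4 : ℝ) + 1) * ((4 : ℝ) + 4)) ^ 2 * (α / 2048 * b') ≤
        226 * (8 * ((4 : ℝ) + 1) * ((4 : ℝ) + 4)) ^ 2 * (α / 2048 * (α / 2048)) :=
      mul_le_mul_of_nonneg_left (mul_le_mul_of_nonneg_left hb'α (by positivity)) (by positivity)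
    have h2 : α * α ≤ α * (1 / 10 ^ 9) := mul_le_mul_of_nonneg_left hα5 hα.le
    nlinarith only [hC0b, h1, h2, hb'α, hα]
  · -- current: `12(c' + K b'²) ≤ 12(α∕24 + α∕2048²) < α`
    have h1 : c' + curConst 4 L * b' ^ 2 ≤ α / 24 + α / 2048 / 2048 := by linarith only [hc'α, hKb, hb'α]
    nlinarith only [h1, hα]

variable {N : ℕ}

/-! ## §2 The window recipe, line-exact and linear -/

/-- **THE WINDOW RECIPE, LINE-EXACT** — `LeafSlot` AT RR-1's OBJECT FROM ITS THREE CONTENT CLAUSES with N07's leaf letters entering ONLY through the slot's own four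
displayed `(b', c')`-lines (regularity, frame, (3.35) size `< α`, current `< α`): at a family `F` and an NE3 object `o`, given N05's constants with the eleven-line window
at `c₁'` and `5·4·F.L·B₀ ≤ B₁'`, an averaging letter `α` with `α ≤ c₁'∕177`, `α ≤ o.Λ₁∕(1770·B+1)`, `α ≤ c2' 4 F.L∕2`, `α ≤ 10⁻⁹` (`B = 5·4·F.L·B₀`), bundle letters
`o.ε < α`, `0 < o.Λ₁`, `177·α·(B_h+B) ≤ o.Λ₂'` (`B_h = 5·4·F.L·B₀β`): `Thm4Body → Prop3Body → LeafH3sup 4 F.L o.Nper o.ε b' c' o.dom → LeafSlot (ne3OfRecord₁₁ F o)` (`Mc = 0`,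
`𝒬 ≡ ∅`, `C₃₃₅ = 1`).  Necessary-and-sufficient in `(b', c')` w.r.t. the slot; file 13 §2 (`b', c' ≤ α²`) and `…_linear` below are instances. [folklore] -/
theorem leafSlot_ofRecord_of_window_lines (F : T4Family) (o : NE3Objects₁₁ N)
    {len : Site 4 → ℝ} (hlen : ∀ v : Site 4, 0 < len v → 1 ≤ len v) (hlen1 : ∀ μ : Fin 4, len (e μ) = 1)
    {c₁ c₁' B₁' cP C₂ B₀β : ℝ} {inp : B8.B9Inputs} (hB₁' : 0 < B₁') (hBB : 5 * ((4 : ℕ) : ℝ) * F.L * inp.B₀ ≤ B₁') (hc₁' : 0 < c₁')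
    (hwin : ∀ α₀ α₁ : ℝ, 0 < α₀ → 0 < α₁ → α₀ + α₁ ≤ c₁' →
      α₀ + α₁ ≤ c₁ ∧ C0 4 * (2 * α₀) ≤ 1 / 3 ∧ 4 * α₀ ≤ c2' 4 F.L ∧ 16 * (B₁' * (α₀ + α₁)) ≤ 1 ∧
      Real.exp (4 * (800 * (((4 : ℕ) : ℝ) + 1) ^ 2 * (((4 : ℕ) : ℝ) + 4)) * α₀) * (1 + 8 * (131072 * (((4 : ℕ) : ℝ) + 1) ^ 2) * (B₁' * (α₀ + α₁))) ≤ 2 ∧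
      2 * (B₁' * (α₀ + α₁)) ≤ c3 4 F.L ∧ ((4 : ℕ) : ℝ) * F.L * α₁ ≤ 1 / 8 ∧ α₀ ≤ cP ∧ α₁ ≤ cP ∧ B₁' * (α₀ + α₁) ≤ cP ∧
      2 * (B₁' * (α₀ + α₁)) ^ 2 + 20 * ((4 : ℕ) : ℝ) * α₀ * (B₁' * (α₀ + α₁)) + 2 * C₂ * (B₁' * (α₀ + α₁)) ^ 2 ≤ α₀ + α₁)
    {α : ℝ} (hα : 0 < α) (hα1 : α ≤ c₁' / 177) (hα2 : α ≤ o.Λ₁ / (1770 * (5 * ((4 : ℕ) : ℝ) * F.L * inp.B₀) + 1))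
    (hα3 : α ≤ c2' 4 F.L / 2) (hα5 : α ≤ 1 / 10 ^ 9)
    (hε : o.ε < α) (hΛ₁ : 0 < o.Λ₁) (hΛ₂' : 177 * α * (5 * ((4 : ℕ) : ℝ) * F.L * B₀β + 5 * ((4 : ℕ) : ℝ) * F.L * inp.B₀) ≤ o.Λ₂')
    {b' c' : ℝ} (hb' : 0 ≤ b') (hc' : 0 ≤ c')
    (hRb : 2 ^ 15 * ((4 : ℝ) + 1) ^ 2 * ((4 : ℝ) + 4) ^ 2 * (F.L : ℝ) ^ 2 * b' ≤ 1)
    (hcF : 23040 * (4 : ℝ) ^ 4 * (frameC 4 F.L + 4) ^ 3 * (c' + curConst 4 F.L * b' ^ 2) ≤ 1)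
    (hXα : b' + 226 * (8 * ((4 : ℝ) + 1) * ((4 : ℝ) + 4)) ^ 2 * b' ^ 2 < α) (hY : 4 * ((4 : ℝ) - 1) * (c' + curConst 4 F.L * b' ^ 2) < α) :
    letI : CStarAlgebra (Matrix (Fin N) (Fin N) ℂ) := {}
    B8.Thm4Body c₁ B₁' (fun i : {i : ZdIdx 4 F.L // i.Ω 0 = Set.univ} => (zdGF3 (Matrix (Fin N) (Fin N) ℂ) F.L 1 len i.1).toGFData) →
      B8.Prop3Body cP 4 (F.L : ℝ) C₂ inp B₀β
        (fun i : {i : ZdIdx 4 F.L // i.Ω 0 = Set.univ} => (zdGF3 (Matrix (Fin N) (Fin N) ℂ) F.L 1 len i.1).toGFData2) →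
      LeafH3sup 4 F.L o.Nper o.ε b' c' o.dom →
      LeafSlot (ne3OfRecord₁₁ F o) := by
  letI : CStarAlgebra (Matrix (Fin N) (Fin N) ℂ) := {}
  intro hT hP h3
  have hL0 : (0 : ℝ) < F.L := by have := HistoryFlow.two_le_L F; positivity
  have hB0 : 0 < 5 * ((4 : ℕ) : ℝ) * F.L * inp.B₀ := by have := inp.B₀_pos; positivity
  have h16' : 16 * (B₁' * c₁') ≤ 1 := by
    obtain ⟨-, -, -, h, -⟩ := hwin (c₁' / 2) (c₁' / 2) (by linarith) (by linarith) (by linarith)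
    rwa [add_halves] at h
  obtain ⟨h16, hA3, hA2, hAs, hAc, hMcα, hC335, hss, hgrad, hℓ, hhol⟩ :=
    slotLetterLines F.L (c' + curConst 4 F.L * b' ^ 2) hα hα1 hα2 hα3 hα5 hB0 hBB hc₁' h16' hΛ₁ hΛ₂' hXα
  exact ⟨len, c₁, c₁', B₁', cP, C₂, B₀β, inp, _, _, b', c', α, 0, 1, fun _ => ∅, hlen, hlen1, hB₁', hBB, rfl, rfl, h16, hwin,
    hb', hc', hRb, hcF, hα, hA3, hA2, hAs, hAc, hXα, hY, le_rfl, hMcα, fun _ _ hq => hq.elim, hC335, hε, hss, hgrad, hℓ, hhol, hT, hP, h3⟩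

/-- **THE WINDOW RECIPE, LINEAR** (dag-ref-B READ-445): the same with N07's leaf letters LINEAR in the averaging letter — `0 ≤ b' ≤ α∕2048`, `0 ≤ c' ≤ α∕24` — and the
fifth α-bound `α ≤ 1∕((M_L+12)(1+K_L)+1)`; the class radius `o.ε < α` stays free, so N07's linear leaf `b' = c' = C·ε` is admissible at `ε ≤ α∕(2048·C)`. [folklore] -/
theorem leafSlot_ofRecord_of_window_linear (F : T4Family) (o : NE3Objects₁₁ N)
    {len : Site 4 → ℝ} (hlen : ∀ v : Site 4, 0 < len v → 1 ≤ len v) (hlen1 : ∀ μ : Fin 4, len (e μ) = 1)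
    {c₁ c₁' B₁' cP C₂ B₀β : ℝ} {inp : B8.B9Inputs} (hB₁' : 0 < B₁') (hBB : 5 * ((4 : ℕ) : ℝ) * F.L * inp.B₀ ≤ B₁') (hc₁' : 0 < c₁')
    (hwin : ∀ α₀ α₁ : ℝ, 0 < α₀ → 0 < α₁ → α₀ + α₁ ≤ c₁' →
      α₀ + α₁ ≤ c₁ ∧ C0 4 * (2 * α₀) ≤ 1 / 3 ∧ 4 * α₀ ≤ c2' 4 F.L ∧ 16 * (B₁' * (α₀ + α₁)) ≤ 1 ∧
      Real.exp (4 * (800 * (((4 : ℕ) : ℝ) + 1) ^ 2 * (((4 : ℕ) : ℝ) + 4)) * α₀) * (1 + 8 * (131072 * (((4 : ℕ) : ℝ) + 1) ^ 2) * (B₁' * (α₀ + α₁))) ≤ 2 ∧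
      2 * (B₁' * (α₀ + α₁)) ≤ c3 4 F.L ∧ ((4 : ℕ) : ℝ) * F.L * α₁ ≤ 1 / 8 ∧ α₀ ≤ cP ∧ α₁ ≤ cP ∧ B₁' * (α₀ + α₁) ≤ cP ∧
      2 * (B₁' * (α₀ + α₁)) ^ 2 + 20 * ((4 : ℕ) : ℝ) * α₀ * (B₁' * (α₀ + α₁)) + 2 * C₂ * (B₁' * (α₀ + α₁)) ^ 2 ≤ α₀ + α₁)
    {α : ℝ} (hα : 0 < α) (hα1 : α ≤ c₁' / 177) (hα2 : α ≤ o.Λ₁ / (1770 * (5 * ((4 : ℕ) : ℝ) * F.L * inp.B₀) + 1))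
    (hα3 : α ≤ c2' 4 F.L / 2) (hα4 : α ≤ 1 / ((23040 * (4 : ℝ) ^ 4 * (frameC 4 F.L + 4) ^ 3 + 12) * (1 + curConst 4 F.L) + 1))
    (hα5 : α ≤ 1 / 10 ^ 9)
    (hε : o.ε < α) (hΛ₁ : 0 < o.Λ₁) (hΛ₂' : 177 * α * (5 * ((4 : ℕ) : ℝ) * F.L * B₀β + 5 * ((4 : ℕ) : ℝ) * F.L * inp.B₀) ≤ o.Λ₂')
    {b' c' : ℝ} (hb' : 0 ≤ b') (hb'α : b' ≤ α / 2048) (hc' : 0 ≤ c') (hc'α : c' ≤ α / 24) :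
    letI : CStarAlgebra (Matrix (Fin N) (Fin N) ℂ) := {}
    B8.Thm4Body c₁ B₁' (fun i : {i : ZdIdx 4 F.L // i.Ω 0 = Set.univ} => (zdGF3 (Matrix (Fin N) (Fin N) ℂ) F.L 1 len i.1).toGFData) →
      B8.Prop3Body cP 4 (F.L : ℝ) C₂ inp B₀β
        (fun i : {i : ZdIdx 4 F.L // i.Ω 0 = Set.univ} => (zdGF3 (Matrix (Fin N) (Fin N) ℂ) F.L 1 len i.1).toGFData2) →
      LeafH3sup 4 F.L o.Nper o.ε b' c' o.dom →
      LeafSlot (ne3OfRecord₁₁ F o) :=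
  have h := leafLines_of_linear (le_trans one_le_two (HistoryFlow.two_le_L F)) hα hα3 hα4 hα5 hb' hb'α hc'α
  leafSlot_ofRecord_of_window_lines F o hlen hlen1 hB₁' hBB hc₁' hwin hα hα1 hα2 hα3 hα5 hε hΛ₁ hΛ₂' hb' hc' h.1 h.2.1 h.2.2.1 h.2.2.2

/-! ## §3 THE N16 LINE at the reading of record, linear currency -/

section ReadingOfRecord

variable [NeZero N] (Rg : (F : T4Family) → Stage12Params F N → Prop)
  (w1 : (F : T4Family) → (θ : Stage12Params F N) → Node00.W1.ReadingData F (Node00.MatA N) θ.τ9.M)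
  (ne2 : (F : T4Family) → Stage12Params F N → (ℕ → ℝ) → List (ULoop F) → ℕ → NE2Objects₁₁)
  (ne1 : (F : T4Family) → Stage12Params F N → (ℕ → ℝ) → List (ULoop F) → NE1pCarriers)
  (ℓ : T4Family → NE3Letters₁₁)
  -- N05's constants, per family; the averaging letter in N05's window and N07's leaf letters, per family
  {len : T4Family → Site 4 → ℝ} {c₁ c₁' B₁' cP C₂ B₀β : T4Family → ℝ} {inp : T4Family → B8.B9Inputs} {α b' c' : T4Family → ℝ}
  (hlen : ∀ (F : T4Family) (v : Site 4), 0 < len F v → 1 ≤ len F v) (hlen1 : ∀ (F : T4Family) (μ : Fin 4), len F (e μ) = 1)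
  (hB₁' : ∀ F, 0 < B₁' F) (hBB : ∀ F : T4Family, 5 * ((4 : ℕ) : ℝ) * F.L * (inp F).B₀ ≤ B₁' F) (hc₁' : ∀ F, 0 < c₁' F)
  (hwin : ∀ (F : T4Family) (α₀ α₁ : ℝ), 0 < α₀ → 0 < α₁ → α₀ + α₁ ≤ c₁' F →
    α₀ + α₁ ≤ c₁ F ∧ C0 4 * (2 * α₀) ≤ 1 / 3 ∧ 4 * α₀ ≤ c2' 4 F.L ∧ 16 * (B₁' F * (α₀ + α₁)) ≤ 1 ∧
    Real.exp (4 * (800 * (((4 : ℕ) : ℝ) + 1) ^ 2 * (((4 : ℕ) : ℝ) + 4)) * α₀) * (1 + 8 * (131072 * (((4 : ℕ) : ℝ) + 1) ^ 2) * (B₁' F * (α₀ + α₁))) ≤ 2 ∧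
    2 * (B₁' F * (α₀ + α₁)) ≤ c3 4 F.L ∧ ((4 : ℕ) : ℝ) * F.L * α₁ ≤ 1 / 8 ∧ α₀ ≤ cP F ∧ α₁ ≤ cP F ∧ B₁' F * (α₀ + α₁) ≤ cP F ∧
    2 * (B₁' F * (α₀ + α₁)) ^ 2 + 20 * ((4 : ℕ) : ℝ) * α₀ * (B₁' F * (α₀ + α₁)) + 2 * C₂ F * (B₁' F * (α₀ + α₁)) ^ 2 ≤ α₀ + α₁)
  (hα : ∀ F, 0 < α F) (hα1 : ∀ F, α F ≤ c₁' F / 177)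
  (hα2 : ∀ F : T4Family, α F ≤ (ℓ F).Λ₁ / (1770 * (5 * ((4 : ℕ) : ℝ) * F.L * (inp F).B₀) + 1))
  (hα3 : ∀ F : T4Family, α F ≤ c2' 4 F.L / 2)
  (hα4 : ∀ F : T4Family, α F ≤ 1 / ((23040 * (4 : ℝ) ^ 4 * (frameC 4 F.L + 4) ^ 3 + 12) * (1 + curConst 4 F.L) + 1))
  (hα5 : ∀ F, α F ≤ 1 / 10 ^ 9)
  (hg : ∀ F, 0 < (ℓ F).g) (hε0 : ∀ F, 0 < (ℓ F).ε) (hε : ∀ F, (ℓ F).ε < α F)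
  (hΛ₁r : ∀ F : T4Family, (ℓ F).Λ₁ ≤ radiusOfRecord N F.L (ne3NperOfRecord₁₁ F 0 0))
  (hb : ∀ F, 0 ≤ (ℓ F).b ∧ (ℓ F).b ≤ (ℓ F).ε / 2) (hC : ∀ F : T4Family, constOfRecord N F.L (ne3NperOfRecord₁₁ F 0 0) (ℓ F).g ≤ (ℓ F).C)
  (hΛ₂' : ∀ F : T4Family, 177 * α F * (5 * ((4 : ℕ) : ℝ) * F.L * B₀β F + 5 * ((4 : ℕ) : ℝ) * F.L * (inp F).B₀) ≤ (ℓ F).Λ₂')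
  (hb' : ∀ F, 0 ≤ b' F ∧ b' F ≤ α F / 2048) (hc' : ∀ F, 0 ≤ c' F ∧ c' F ≤ α F / 24)
include hlen hlen1 hB₁' hBB hc₁' hwin hα hα1 hα2 hα3 hα4 hα5 hg hε0 hε hΛ₁r hb hC hΛ₂' hb' hc'

/-- Per family: the proviso and — from the content — the slot, at windowed letters `ℓ F` in the linear currency. [folklore] -/
theorem inEndRegime_and_leafSlot_ofRecord_of_window_linear (F : T4Family)
    (hT : letI : CStarAlgebra (Matrix (Fin N) (Fin N) ℂ) := {}
      B8.Thm4Body (c₁ F) (B₁' F) (fun i : {i : ZdIdx 4 F.L // i.Ω 0 = Set.univ} => (zdGF3 (Matrix (Fin N) (Fin N) ℂ) F.L 1 (len F) i.1).toGFData))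
    (hP : letI : CStarAlgebra (Matrix (Fin N) (Fin N) ℂ) := {}
      B8.Prop3Body (cP F) 4 (F.L : ℝ) (C₂ F) (inp F) (B₀β F)
        (fun i : {i : ZdIdx 4 F.L // i.Ω 0 = Set.univ} => (zdGF3 (Matrix (Fin N) (Fin N) ℂ) F.L 1 (len F) i.1).toGFData2))
    (h3 : LeafH3sup 4 F.L (ne3NperOfRecord₁₁ F 0 0) (ℓ F).ε (b' F) (c' F) (ne3DomOfRecord₁₁ F N 0 0)) :
    InEndRegime (ne3OfRecord₁₁ F (ne3ConstLayerOfRecord₁₁ F N (ℓ F))) ∧ LeafSlot (ne3OfRecord₁₁ F (ne3ConstLayerOfRecord₁₁ F N (ℓ F))) := by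
  letI : CStarAlgebra (Matrix (Fin N) (Fin N) ℂ) := {}
  have hB0 : 0 < 5 * ((4 : ℕ) : ℝ) * F.L * (inp F).B₀ := by
    have := (inp F).B₀_pos; have := HistoryFlow.two_le_L F; positivity
  refine ⟨inEndRegime_ofRecord_of_window F (ne3ConstLayerOfRecord₁₁ F N (ℓ F)) (one_le_ne3NperOfRecord₁₁ F 0 0) (hg F) hB0.le (hα2 F) (hε0 F) (hε F)
    (hΛ₁r F) (hb F).1 (hb F).2 (hC F), ?_⟩
  -- `0 < Λ₁`: `0 < α ≤ Λ₁∕(1770·B+1) ≤ Λ₁`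
  have hΛpos : 0 < (ℓ F).Λ₁ := by
    have hBp : 0 < 1770 * (5 * ((4 : ℕ) : ℝ) * F.L * (inp F).B₀) + 1 := by positivity
    have h := (le_div_iff₀ hBp).1 (hα2 F)
    have hαp : 0 < α F := hα F
    nlinarith only [h, hB0, hαp]
  exact leafSlot_ofRecord_of_window_linear F (ne3ConstLayerOfRecord₁₁ F N (ℓ F)) (hlen F) (hlen1 F) (hB₁' F) (hBB F) (hc₁' F) (hwin F) (hα F) (hα1 F) (hα2 F)
    (hα3 F) (hα4 F) (hα5 F) (hε F) hΛpos (hΛ₂' F) (hb' F).1 (hb' F).2 (hc' F).1 (hc' F).2 hT hP h3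

/-- **THE N16 LINE AT THE READING OF RECORD, REGIME-RESTRICTED HOME, LINEAR CURRENCY** — file 14's `s_N16_rRec₁₂On_readingOfRecord₁₂_of_window` with N07's leaf letters
`0 ≤ b' F ≤ α F∕2048`, `0 ≤ c' F ≤ α F∕24` (the displayed letter lines are the section's hypotheses); the three content clauses once per guarded family give dag-n27-c's
`h16 : S_N16 (RRec₁₂On (readingOfRecord₁₂ w1 ℓ ne2 ne1) Rg)`. [folklore] -/
theorem s_N16_rRec₁₂On_readingOfRecord₁₂_of_window_linear
    (hcontent : ∀ (F : T4Family), (∃ θ : Stage12Params F N, θ.Provisos₁₂ F N ∧ Rg F θ ∧ θ.Admissible F N) →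
      letI : CStarAlgebra (Matrix (Fin N) (Fin N) ℂ) := {}
      B8.Thm4Body (c₁ F) (B₁' F) (fun i : {i : ZdIdx 4 F.L // i.Ω 0 = Set.univ} => (zdGF3 (Matrix (Fin N) (Fin N) ℂ) F.L 1 (len F) i.1).toGFData) ∧
        B8.Prop3Body (cP F) 4 (F.L : ℝ) (C₂ F) (inp F) (B₀β F)
          (fun i : {i : ZdIdx 4 F.L // i.Ω 0 = Set.univ} => (zdGF3 (Matrix (Fin N) (Fin N) ℂ) F.L 1 (len F) i.1).toGFData2) ∧
        LeafH3sup 4 F.L (ne3NperOfRecord₁₁ F 0 0) (ℓ F).ε (b' F) (c' F) (ne3DomOfRecord₁₁ F N 0 0)) :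
    S_N16 (RRec₁₂On (readingOfRecord₁₂ w1 ℓ ne2 ne1) Rg) :=
  s_N16_rRec₁₂On_readingOfRecord₁₂_of_leafSlot Rg w1 ℓ ne2 ne1 fun F hF =>
    inEndRegime_and_leafSlot_ofRecord_of_window_linear ℓ hlen hlen1 hB₁' hBB hc₁' hwin hα hα1 hα2 hα3 hα4 hα5 hg hε0 hε hΛ₁r hb hC hΛ₂' hb' hc' F
      (hcontent F hF).1 (hcontent F hF).2.1 (hcontent F hF).2.2

/-- **THE N16 LINE AT THE READING OF RECORD, CANONICAL HOME `RRec₁₂`, LINEAR CURRENCY** (content once per family carrying a Stage-12 datum of record; dag-n21-d's `h16`).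
[folklore] -/
theorem s_N16_rRec₁₂_readingOfRecord₁₂_of_window_linear
    (hcontent : ∀ (F : T4Family), (∃ D : Datum F N, IsDatumOfRecord₁₂C F N D) →
      letI : CStarAlgebra (Matrix (Fin N) (Fin N) ℂ) := {}
      B8.Thm4Body (c₁ F) (B₁' F) (fun i : {i : ZdIdx 4 F.L // i.Ω 0 = Set.univ} => (zdGF3 (Matrix (Fin N) (Fin N) ℂ) F.L 1 (len F) i.1).toGFData) ∧
        B8.Prop3Body (cP F) 4 (F.L : ℝ) (C₂ F) (inp F) (B₀β F)
          (fun i : {i : ZdIdx 4 F.L // i.Ω 0 = Set.univ} => (zdGF3 (Matrix (Fin N) (Fin N) ℂ) F.L 1 (len F) i.1).toGFData2) ∧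
        LeafH3sup 4 F.L (ne3NperOfRecord₁₁ F 0 0) (ℓ F).ε (b' F) (c' F) (ne3DomOfRecord₁₁ F N 0 0)) :
    S_N16 (RRec₁₂ (readingOfRecord₁₂ w1 ℓ ne2 ne1)) :=
  s_N16_rRec₁₂_of_constLayer_leafSlot (readingOfRecord₁₂ w1 ℓ ne2 ne1) (fun F => ne3ConstLayerOfRecord₁₁ F N (ℓ F)) (fun _ _ _ _ _ _ => rfl)
    fun F hF => inEndRegime_and_leafSlot_ofRecord_of_window_linear ℓ hlen hlen1 hB₁' hBB hc₁' hwin hα hα1 hα2 hα3 hα4 hα5 hg hε0 hε hΛ₁r hb hC hΛ₂' hb' hc' F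
      (hcontent F hF).1 (hcontent F hF).2.1 (hcontent F hF).2.2

end ReadingOfRecord

end

end Summit.QuantumFields.YangMills.BalabanUVNodes.N16SlotWindowLinear
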